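import Summits.BirchSwinnertonDyer.BirchSwinnertonDyer.Theorems.ClassRecordThreeEulerHalvesAtThreeCartanCoverPrintClausesSurjective
import Summits.BirchSwinnertonDyer.BirchSwinnertonDyer.Theorems.ClassRecordThreeEulerHalvesAtThreeCartanCoverPrintClausesDescentGeneral
import Literature.NumberTheory.Automorphic.QuaternionOrderUnitsCocompact
import Literature.NumberTheory.Automorphic.JordanZassenhaus
import Literature.Geometry.Kaehler.ComplexTorusQuaternionCongruenceSubgroups
import HarnessLib

/-!
# Crux NUM `CartanOnePlaceDegreeLawAtThree` (item 24801), line `lattice` — the print clauses XII: **THE SURJECTIVITY HALF OF (ESᶜ) FOR EVERY ORDER OF EVERY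
# INDEFINITE DIVISION QUATERNION ALGEBRA** — the hypothesis `hdivSurj` of `eichlerShimura_weightTwo_rePeriod_surjective_of_residue` is a theorem

Seat `bsd-stepL-tam3-p1` g29 (LEAD of crux 24801; `--supports stmt-BirchSwinnertonDyer-24801 --as helper`). Brick G2 (the last) of the LEAD's generalisation of the in-tree
surjectivity half of (ESᶜ) `Literature.NumberTheory.Automorphic.eichlerShimura_weightTwo_rePeriod` (Shimura Thm. 8.4 at `n = 0`): for EVERY quaternion algebra `B` over `ℚ` in which
every non-zero element is a unit, EVERY order `O ⊆ B`, EVERY injective `ι : B →ₐ[ℚ] M₂(ℝ)` and every base point `z₀`, every additive `u : ι(O¹) → ℝ` is the real period cochain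
`γ ↦ Re ∫_{z₀}^{γ z₀} F` of a weight-two cusp form `F` on `Γ = ι(O¹) = normOneUnits ι hO`:
**`eichlerShimura_weightTwo_rePeriod_surjective_of_forall_isUnit`** — VERBATIM the hypothesis `hdivSurj` of defn-ty1 g45's bridge
`eichlerShimura_weightTwo_rePeriod_surjective_of_residue` ∕ `eichlerShimura_weightTwo_rePeriod_of_cusp_residue` (`FuchsianEichlerShimuraWeightTwo.lean` §Residue). Consequently
(**`eichlerShimura_weightTwo_rePeriod_of_cusp_residue'`**) the whole named fact (ESᶜ) follows from its two CUSP-CASE residues (ESᶜ-inj-split)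
`eichlerShimura_weightTwo_rePeriod_injective_of_exists_not_isUnit` and (ESᶜ-surj-split) `eichlerShimura_weightTwo_rePeriod_surjective_of_exists_not_isUnit` (the case
`B ≅ M₂(ℚ)`, cusps) ALONE — so a consumer's cite stub may list exactly these two in place of (ESᶜ).

PROOF. §1 tools on `GL₂(ℝ)`-subgroups (cocompactness along finitely many cosets; proper discontinuity of a subgroup lying elementwise in a conjugate `h Γ₀ h⁻¹` of a properly
discontinuous `Γ₀ ≤ SL₂(ℝ)`; compact quotient). §2 the LEVEL-`L` predicate «`γ = ι(x)`, `x ∈ O`, `x ≡ 1 (mod L O)`» on `ι(O¹)`: closed under products, inverses and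
`ι(O¹)`-conjugation (a NORMAL subgroup `ι(O¹)(L)`), with FINITELY MANY cosets (coordinates in a `ℤ`-basis of `O` modulo `L`). §3 the TORSION-FREE NORMAL LEVEL: with defn-ty1's
transport datum `exists_conj_congruenceUnitGroup_mem_normOneUnits` (`ι = h ρ(f ·) h⁻¹`, Skolem–Noether) and Jordan–Zassenhaus in the direction `N'' f(O) ⊆ 𝔬`
(`exists_smul_mem_of_fg`), the level `L = 3 N''` group lies in `h Γ_{a,b} h⁻¹`, hence acts properly discontinuously (Hodge lane `properlyDiscontinuousSMul_unitGroup`); it is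
torsion-free by the LEAD's Minkowski lemma at the odd prime `3` (`eq_one_of_isOfFinOrder_of_sub_one_mem`, `…PrintClausesTorsionFree`) and cocompact (defn-ty1's
`exists_isCompact_forall_exists_mem_normOneUnits_smul_mem`, spread over the cosets): `exists_torsionFree_level_subgroup`. §4 ASSEMBLY: that level's quotient is a compact
Riemann surface without cusps (`not_isCusp_normOneUnits`), so `esSurj_of_compactQuotient` (`…PrintClausesSurjective`) gives surjectivity on the level and the general descent
`esSurj_of_normal_finiteIndex` (`…PrintClausesDescentGeneral`) carries it up to `ι(O¹)`.
Theorems only (no definition, no instance, no new named fact); nothing about NUM or any curve is proved; BSD is proved for no curve.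
[cite: ShimuraIATAF1971, Thm. 8.4 p. 234; §8.1 (8.1.2)–(8.1.3); §9.2 p. 246] [cite: VignerasLNM800, Ch. IV §1 Thm. 1.1 p. 104 and Prop. 1.4 p. 105] [cite: FarkasKra1992, III.3.4 Corollary (b)]
-/

set_option linter.dupNamespace false
set_option autoImplicit false

noncomputable section

open scoped MatrixGroups ModularForm Pointwise Quaternion
open Function Set

namespace Summit.BirchSwinnertonDyer.BirchSwinnertonDyer.Theorems.CartanCover.PrintClauses

open Literature.NumberTheory.Automorphic
open Literature.Geometry.Kaehler.ComplexTorus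

/-! ## §1 General tools on subgroups of `GL₂(ℝ)` acting on `ℍ` -/

section Tools
/-- Transport of cocompactness to a subgroup reached by finitely many cosets. [cite: ShimuraIATAF1971, §1.3 Prop. 1.31] -/
theorem exists_isCompact_reps_of_finset_leftCosets {Γ₁ Γ₂ : Subgroup (GL (Fin 2) ℝ)} {K : Set UpperHalfPlane} (hK : IsCompact K)
    (hcov : ∀ z : UpperHalfPlane, ∃ γ ∈ Γ₂, γ • z ∈ K) (T : Finset (GL (Fin 2) ℝ))
    (hT : ∀ γ ∈ Γ₂, ∃ t ∈ T, t⁻¹ * γ ∈ Γ₁) :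
    ∃ K₁ : Set UpperHalfPlane, IsCompact K₁ ∧ ∀ z : UpperHalfPlane, ∃ γ ∈ Γ₁, γ • z ∈ K₁ := by
  classical
  refine ⟨⋃ t ∈ T, (fun z : UpperHalfPlane => t⁻¹ • z) '' K, T.finite_toSet.isCompact_biUnion fun t _ => hK.image (continuous_const_smul _), fun z => ?_⟩
  obtain ⟨γ, hγ, hγz⟩ := hcov z
  obtain ⟨t, ht, htγ⟩ := hT γ hγ
  refine ⟨t⁻¹ * γ, htγ, Set.mem_biUnion ht ⟨γ • z, hγz, ?_⟩⟩
  rw [mul_smul]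

/-- **`Γ∖ℍ` is compact when a compact set meets every orbit.** [cite: ShimuraIATAF1971, §1.5 and Prop. 9.3] -/
theorem compactSpace_orbitQuotient_of_reps (Γ : Subgroup (GL (Fin 2) ℝ)) {K : Set UpperHalfPlane} (hK : IsCompact K)
    (hcov : ∀ z : UpperHalfPlane, ∃ γ ∈ Γ, γ • z ∈ K) : CompactSpace (MulAction.orbitRel.Quotient Γ UpperHalfPlane) := by
  refine ⟨?_⟩
  have hsurj : (Quotient.mk (MulAction.orbitRel Γ UpperHalfPlane)) '' K = Set.univ := by
    refine Set.eq_univ_of_forall fun y => ?_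
    induction y using Quotient.inductionOn with
    | h z =>
      obtain ⟨γ, hγ, hγz⟩ := hcov z
      refine ⟨γ • z, hγz, Quotient.sound ⟨⟨γ, hγ⟩, rfl⟩⟩
  rw [← hsurj]
  exact hK.image continuous_quot_mk

/-- The action of `SL₂(ℝ)` on `ℍ` factors through `GL₂(ℝ)`. -/
private theorem sl_smul_eq_toGL_smul' (γ : SL(2, ℝ)) (z : UpperHalfPlane) :
    γ • z = (Matrix.SpecialLinearGroup.toGL γ : GL (Fin 2) ℝ) • z := by
  rw [MulAction.compHom_smul_def]
  congr 1

/-- **Proper discontinuity transports to a subgroup lying elementwise in a conjugate `h Γ₀ h⁻¹`** of a properly discontinuous `Γ₀ ≤ SL₂(ℝ)` (`h ∈ GL₂(ℝ)` arbitrary):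
`γ K ∩ L ≠ ∅` for `γ = h g h⁻¹` iff `g (h⁻¹K) ∩ h⁻¹L ≠ ∅`, and `γ ↦ g` is injective. [cite: ShimuraIATAF1971, §1.1 Prop. 1.6 ∕ §1.5] -/
theorem properlyDiscontinuousSMul_of_forall_eq_conj (Γ' : Subgroup (GL (Fin 2) ℝ)) {Γ₀ : Subgroup SL(2, ℝ)}
    (hpd : ProperlyDiscontinuousSMul Γ₀ UpperHalfPlane) (h : GL (Fin 2) ℝ)
    (hsub : ∀ γ ∈ Γ', ∃ g ∈ Γ₀, γ = h * Matrix.SpecialLinearGroup.toGL g * h⁻¹) :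
    ProperlyDiscontinuousSMul Γ' UpperHalfPlane := by
  classical
  choose! φ hφmem hφeq using hsub
  refine ⟨fun {K L} hK hL => ?_⟩
  have hfin := hpd.finite_disjoint_inter_image (hK.image (continuous_const_smul h⁻¹)) (hL.image (continuous_const_smul h⁻¹))
  let ψ : Γ' → Γ₀ := fun γ => ⟨φ γ, hφmem γ γ.2⟩
  have hψ : Function.Injective ψ := by
    intro γ₁ γ₂ he
    have he' : φ γ₁ = φ γ₂ := congrArg Subtype.val he
    apply Subtype.ext
    rw [hφeq γ₁ γ₁.2, hφeq γ₂ γ₂.2, he']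
  refine (hfin.preimage hψ.injOn).subset ?_
  intro γ hγ
  rw [Set.mem_setOf_eq] at hγ
  rw [Set.mem_preimage, Set.mem_setOf_eq]
  obtain ⟨l, ⟨k, hk, hkl⟩, hl⟩ := hγ
  refine ⟨h⁻¹ • l, ⟨h⁻¹ • k, ⟨k, hk, rfl⟩, ?_⟩, ⟨l, hl, rfl⟩⟩
  have hkl' : (γ : GL (Fin 2) ℝ) • k = l := hkl
  show ((ψ γ : Γ₀) : SL(2, ℝ)) • (h⁻¹ • k) = h⁻¹ • l
  rw [← hkl', hφeq γ γ.2, sl_smul_eq_toGL_smul']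
  simp only [mul_smul, inv_smul_smul, ψ]
end Tools

/-! ## §2 The level-`L` predicate on `ι(O¹)`: products, inverses, conjugates, finitely many cosets -/

section Level
variable {B : Type*} [Ring B]

/-- Products: `x ≡ 1`, `x' ≡ 1 (mod L O)` ⟹ `x x' ≡ 1 (mod L O)`. [folklore] -/
theorem level_mul {O : Submodule ℤ B} (hO : Brandt.IsOrder B O) (L : ℕ) {x x' : B} (hx' : x' ∈ O)
    (hy : ∃ y ∈ O, x - 1 = (L : ℤ) • y) (hy' : ∃ y' ∈ O, x' - 1 = (L : ℤ) • y') : ∃ y'' ∈ O, x * x' - 1 = (L : ℤ) • y'' := by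
  obtain ⟨y, hy, hxy⟩ := hy
  obtain ⟨y', hy', hxy'⟩ := hy'
  refine ⟨y * x' + y', O.add_mem (hO.mul_mem y hy x' hx') hy', ?_⟩
  calc x * x' - 1 = (x - 1) * x' + (x' - 1) := by noncomm_ring
    _ = (L : ℤ) • (y * x' + y') := by rw [hxy, hxy', smul_mul_assoc, smul_add]

/-- Inverses: `x z = 1`, `x ≡ 1 (mod L O)` ⟹ `z ≡ 1 (mod L O)`. [folklore] -/
theorem level_inv {O : Submodule ℤ B} (hO : Brandt.IsOrder B O) (L : ℕ) {x z : B} (hz : z ∈ O) (hxz : z * x = 1)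
    (hy : ∃ y ∈ O, x - 1 = (L : ℤ) • y) : ∃ y' ∈ O, z - 1 = (L : ℤ) • y' := by
  obtain ⟨y, hy, hxy⟩ := hy
  refine ⟨-(z * y), O.neg_mem (hO.mul_mem z hz y hy), ?_⟩
  calc z - 1 = z - z * x := by rw [hxz]
    _ = -(z * (x - 1)) := by noncomm_ring
    _ = (L : ℤ) • -(z * y) := by rw [hxy, mul_smul_comm, smul_neg]

/-- Conjugates: `t s = 1`, `x ≡ 1 (mod L O)` ⟹ `t x s ≡ 1 (mod L O)` (`t, s ∈ O`). [folklore] -/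
theorem level_conj {O : Submodule ℤ B} (hO : Brandt.IsOrder B O) (L : ℕ) {x t s : B} (ht : t ∈ O) (hs : s ∈ O) (hts : t * s = 1)
    (hy : ∃ y ∈ O, x - 1 = (L : ℤ) • y) : ∃ y' ∈ O, t * x * s - 1 = (L : ℤ) • y' := by
  obtain ⟨y, hy, hxy⟩ := hy
  refine ⟨t * y * s, hO.mul_mem _ (hO.mul_mem t ht y hy) s hs, ?_⟩
  calc t * x * s - 1 = t * x * s - t * s := by rw [hts]
    _ = t * (x - 1) * s := by noncomm_ring
    _ = (L : ℤ) • (t * y * s) := by rw [hxy, mul_smul_comm, smul_mul_assoc]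

variable [Algebra ℚ B] [IsQuaternionAlgebra ℚ B] (ι : B →ₐ[ℚ] Matrix (Fin 2) (Fin 2) ℝ) {O : Submodule ℤ B}

/-- **Finitely many cosets of the level-`L` subgroup in `ι(O¹)`** (`L ≠ 0`): finitely many `t ∈ ι(O¹)` such that every `γ ∈ ι(O¹)` has `t⁻¹ γ = ι(x)` with `x ≡ 1 (mod L O)` —
two elements with the same coordinates modulo `L` in a `ℤ`-basis of `O` differ by an element of `L O`. [cite: VignerasLNM800, Ch. IV §1] [cite: KohenPacetti2016, §2] -/
theorem exists_finset_leftCosets_level (hι : Function.Injective ι) (hO : Brandt.IsOrder B O) {L : ℕ} (hL : L ≠ 0) :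
    ∃ T : Finset (GL (Fin 2) ℝ), (∀ t ∈ T, t ∈ normOneUnits ι hO) ∧
      ∀ γ ∈ normOneUnits ι hO, ∃ t ∈ T, ∃ x ∈ O, ι x = ((t⁻¹ * γ : GL (Fin 2) ℝ) : Matrix (Fin 2) (Fin 2) ℝ) ∧ ∃ y ∈ O, x - 1 = (L : ℤ) • y := by
  classical
  haveI : NeZero L := ⟨hL⟩
  obtain ⟨b⟩ := hO.isFullLattice.nonempty_basis_fin_four
  let coord : O → (Fin 4 → ZMod L) := fun x i => ((b.repr x i : ℤ) : ZMod L)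
  have hcoord : ∀ x y : O, coord x = coord y → ∃ z : O, (x : B) - y = (L : ℤ) • (z : B) := by
    intro x y hxy
    have hdiv : ∀ i, (L : ℤ) ∣ b.repr x i - b.repr y i := by
      intro i
      have h := congr_fun hxy i
      exact (ZMod.intCast_eq_intCast_iff_dvd_sub _ _ _).mp h.symm
    choose c hc using hdiv
    refine ⟨Finsupp.linearCombination ℤ b (Finsupp.equivFunOnFinite.symm c), ?_⟩
    have hrepr : b.repr (x - y) = (L : ℤ) • Finsupp.equivFunOnFinite.symm c := by
      ext i
      simp [hc i]
    have hxmy : x - y = (L : ℤ) • Finsupp.linearCombination ℤ b (Finsupp.equivFunOnFinite.symm c) := by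
      apply b.repr.injective
      rw [hrepr, map_zsmul, b.repr_linearCombination]
    have := congrArg (fun v : O => (v : B)) hxmy
    simpa using this
  have hlift : ∀ γ ∈ normOneUnits ι hO, ∃ u : O, ι (u : B) = (γ : Matrix (Fin 2) (Fin 2) ℝ) := by
    rintro γ ⟨⟨x, hx, hxγ⟩, -, -⟩
    exact ⟨⟨x, hx⟩, hxγ⟩
  choose! lift hliftι using hlift
  have hfin : (Set.range fun γ : normOneUnits ι hO => coord (lift γ)).Finite := Set.toFinite _
  have hrep : ∀ v ∈ Set.range (fun γ : normOneUnits ι hO => coord (lift γ)),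
      ∃ t : GL (Fin 2) ℝ, t ∈ normOneUnits ι hO ∧ coord (lift t) = v := by
    rintro v ⟨γ, rfl⟩
    exact ⟨γ, γ.2, rfl⟩
  choose! rep hrepmem hrepcoord using hrep
  refine ⟨hfin.toFinset.image rep, ?_, ?_⟩
  · intro t ht
    obtain ⟨v, hv, rfl⟩ := Finset.mem_image.mp ht
    exact hrepmem v (hfin.mem_toFinset.mp hv)
  · intro γ hγ
    set v := coord (lift γ) with hvdef
    have hv : v ∈ Set.range (fun γ : normOneUnits ι hO => coord (lift γ)) := ⟨⟨γ, hγ⟩, rfl⟩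
    refine ⟨rep v, Finset.mem_image.mpr ⟨v, hfin.mem_toFinset.mpr hv, rfl⟩, ?_⟩
    have ht := hrepmem v hv
    have hc : coord (lift (rep v)) = coord (lift γ) := by rw [hrepcoord v hv]
    obtain ⟨z, hz⟩ := hcoord _ _ hc
    obtain ⟨⟨xt, hxt, hxtι⟩, ⟨yt, hyt, hytι⟩, hdet_t⟩ := ht
    obtain ⟨⟨xγ, hxγ, hxγι⟩, ⟨yγ, hyγ, hyγι⟩, hdet_γ⟩ := hγ
    have hut : (lift (rep v) : B) = xt := hι (by rw [hliftι _ ⟨⟨xt, hxt, hxtι⟩, ⟨yt, hyt, hytι⟩, hdet_t⟩, hxtι])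
    have huγ : (lift γ : B) = xγ := hι (by rw [hliftι _ ⟨⟨xγ, hxγ, hxγι⟩, ⟨yγ, hyγ, hyγι⟩, hdet_γ⟩, hxγι])
    have hyx : yt * xt = 1 := hι (by rw [map_mul, hytι, hxtι, ← Units.val_mul, inv_mul_cancel, Units.val_one, map_one])
    refine ⟨yt * xγ, hO.mul_mem yt hyt xγ hxγ, by rw [map_mul, hytι, hxγι, Units.val_mul], -(yt * (z : B)),
      O.neg_mem (hO.mul_mem yt hyt _ z.2), ?_⟩
    have e : (xt : B) - xγ = (L : ℤ) • (z : B) := by rw [← hut, ← huγ]; exact hz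
    calc yt * xγ - 1 = yt * xγ - yt * xt := by rw [hyx]
      _ = -(yt * (xt - xγ)) := by noncomm_ring
      _ = (L : ℤ) • -(yt * (z : B)) := by rw [e, mul_smul_comm, smul_neg]
end Level

/-! ## §3 A torsion-free, cocompact, properly discontinuous NORMAL LEVEL of finite index in `ι(O¹)`, `B` a division algebra -/

section TorsionFreeLevel
variable {B : Type*} [Ring B] [Algebra ℚ B] [IsQuaternionAlgebra ℚ B] (ι : B →ₐ[ℚ] Matrix (Fin 2) (Fin 2) ℝ) {O : Submodule ℤ B} (hO : Brandt.IsOrder B O)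

/-- In a quaternion algebra, `det ρ(ε) = 1` forces `ε ε̄ = 1`. [cite: Bergeron2016, §2.2 proof of Thm. 2.3 p. 37] -/
private theorem mul_star_eq_one_of_det {a b : ℤ} (hb : 0 ≤ b) {ε : ℍ[ℚ,(a : ℚ),(b : ℚ)]}
    (hdet : (QuaternionType.rho a b hb (QuaternionType.castQ a b ε)).det = 1) : ε * star ε = 1 := by
  rw [QuaternionType.det_rho_castQ] at hdet
  have h1 : (ε * star ε).re = 1 := by exact_mod_cast hdet
  rw [QuaternionAlgebra.mul_star_eq_coe, h1]
  rfl

/-- **THE TORSION-FREE NORMAL LEVEL.** For a division quaternion algebra `B` over `ℚ`, any order `O` and any injective `ι : B →ₐ[ℚ] M₂(ℝ)` there is a subgroup `Γ' ≤ Γ = ι(O¹)`,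
NORMAL and of FINITE INDEX in `Γ`, acting PROPERLY DISCONTINUOUSLY on `ℍ`, TORSION-FREE, and COCOMPACT (a compact subset of `ℍ` meets every `Γ'`-orbit) — namely the principal
level `ι(O¹)(L) = {ι(x) : x ∈ O¹, x ≡ 1 (mod L O)}`, `L = 3N''` with `N'' f(O) ⊆ 𝔬` (`f : B ≅ (a, b)_ℚ`, `𝔬 = ℤ⟨1,i,j,ij⟩`, Jordan–Zassenhaus), which lies in the conjugate
`h Γ_{a,b} h⁻¹` of the Hodge lane's Fuchsian group (Skolem–Noether, defn-ty1's transport datum) and is torsion-free by Minkowski at the odd prime `3`.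
[cite: VignerasLNM800, Ch. IV §1 Thm. 1.1 p. 104 and Prop. 1.4 p. 105] [cite: ShimuraIATAF1971, §9.2 p. 246 and §1.3 Prop. 1.31] [cite: Bergeron2016, §2.3.1 p. 44] -/
theorem exists_torsionFree_level_subgroup (hι : Function.Injective ι) (hdiv : ∀ x : B, x ≠ 0 → IsUnit x) :
    ∃ Γ' : Subgroup (GL (Fin 2) ℝ), Γ' ≤ normOneUnits ι hO ∧ (Γ'.subgroupOf (normOneUnits ι hO)).Normal ∧
      (Γ'.subgroupOf (normOneUnits ι hO)).FiniteIndex ∧ ProperlyDiscontinuousSMul Γ' UpperHalfPlane ∧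
      (∀ γ : Γ', IsOfFinOrder γ → γ = 1) ∧ ∃ K : Set UpperHalfPlane, IsCompact K ∧ ∀ z : UpperHalfPlane, ∃ γ ∈ Γ', γ • z ∈ K := by
  classical
  -- transport datum `ι = h ρ(f ·) h⁻¹`
  obtain ⟨a, b, hb, f, h, N, ha, -, hconj, -⟩ := exists_conj_congruenceUnitGroup_mem_normOneUnits B O hO ι
  -- Jordan–Zassenhaus: `N'' f(O) ⊆ 𝔬`
  let fZ : B →ₗ[ℤ] ℍ[ℚ,(a : ℚ),(b : ℚ)] := (f : B →+* ℍ[ℚ,(a : ℚ),(b : ℚ)]).toAddMonoidHom.toIntLinearMap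
  obtain ⟨n, hn0, hn⟩ := exists_smul_mem_of_fg (QuaternionType.isOrder_orderSubmodule a b).isFullLattice (hO.isFullLattice.1.map fZ)
  have hnmem : ∀ y ∈ O, (n.natAbs : ℤ) • f y ∈ QuaternionType.order a b := by
    intro y hy
    have hx : f y ∈ O.map fZ := Submodule.mem_map_of_mem (f := fZ) hy
    have h1 : n • f y ∈ QuaternionType.orderSubmodule a b := hn _ hx
    rw [QuaternionType.mem_orderSubmodule_iff] at h1
    rcases Int.natAbs_eq n with h' | h'
    · rwa [← h']
    · have h2 : (n.natAbs : ℤ) = -n := by omega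
      rw [h2, neg_smul]
      exact (QuaternionType.order a b).neg_mem h1
  set L : ℕ := 3 * n.natAbs with hLdef
  have hL0 : L ≠ 0 := by rw [hLdef]; exact mul_ne_zero (by norm_num) (Int.natAbs_ne_zero.mpr hn0)
  -- the level-`L` subgroup
  let S : Set (GL (Fin 2) ℝ) := {g | g ∈ normOneUnits ι hO ∧ ∃ x ∈ O, ι x = (g : Matrix (Fin 2) (Fin 2) ℝ) ∧ ∃ y ∈ O, x - 1 = (L : ℤ) • y}
  have hS_one : (1 : GL (Fin 2) ℝ) ∈ S := ⟨(normOneUnits ι hO).one_mem, 1, hO.one_mem, by simp, 0, O.zero_mem, by simp⟩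
  have hS_mul : ∀ g ∈ S, ∀ g' ∈ S, g * g' ∈ S := by
    rintro g ⟨hg, x, hx, hxg, hy⟩ g' ⟨hg', x', hx', hxg', hy'⟩
    exact ⟨(normOneUnits ι hO).mul_mem hg hg', x * x', hO.mul_mem x hx x' hx', by rw [map_mul, hxg, hxg', Units.val_mul], level_mul hO L hx' hy hy'⟩
  have hS_inv : ∀ g ∈ S, g⁻¹ ∈ S := by
    rintro g ⟨hg, x, hx, hxg, hy⟩
    obtain ⟨-, ⟨z, hz, hzg⟩, -⟩ := id hg
    have hzx : z * x = 1 := hι (by rw [map_mul, hzg, hxg, ← Units.val_mul, inv_mul_cancel, Units.val_one, map_one])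
    exact ⟨(normOneUnits ι hO).inv_mem hg, z, hz, hzg, level_inv hO L hz hzx hy⟩
  let Γ' : Subgroup (GL (Fin 2) ℝ) :=
    { carrier := S
      one_mem' := hS_one
      mul_mem' := fun {g g'} hg hg' => hS_mul g hg g' hg'
      inv_mem' := fun {g} hg => hS_inv g hg }
  have hmemΓ' : ∀ g : GL (Fin 2) ℝ, g ∈ Γ' ↔ g ∈ S := fun g => Iff.rfl
  have hle : Γ' ≤ normOneUnits ι hO := fun g hg => ((hmemΓ' g).mp hg).1
  -- normality
  have hnormal : (Γ'.subgroupOf (normOneUnits ι hO)).Normal := by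
    refine ⟨fun γ hγ g => ?_⟩
    rw [Subgroup.mem_subgroupOf] at hγ ⊢
    rw [Subgroup.coe_mul, Subgroup.coe_mul, Subgroup.coe_inv, hmemΓ']
    obtain ⟨hγ₁, x, hx, hxγ, hy⟩ := (hmemΓ' _).mp hγ
    obtain ⟨⟨t, ht, htg⟩, ⟨s, hs, hsg⟩, -⟩ := g.2
    have hts : t * s = 1 := hι (by rw [map_mul, htg, hsg, ← Units.val_mul, mul_inv_cancel, Units.val_one, map_one])
    refine ⟨(normOneUnits ι hO).mul_mem ((normOneUnits ι hO).mul_mem g.2 hγ₁) ((normOneUnits ι hO).inv_mem g.2), t * x * s,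
      hO.mul_mem _ (hO.mul_mem t ht x hx) s hs, by rw [map_mul, map_mul, htg, hxγ, hsg, Units.val_mul, Units.val_mul], level_conj hO L ht hs hts hy⟩
  -- finitely many cosets
  obtain ⟨T, hT, hcos⟩ := exists_finset_leftCosets_level ι hι hO hL0
  have hcos' : ∀ γ ∈ normOneUnits ι hO, ∃ t ∈ T, t⁻¹ * γ ∈ Γ' := by
    intro γ hγ
    obtain ⟨t, ht, x, hx, hxι, hy⟩ := hcos γ hγ
    exact ⟨t, ht, (hmemΓ' _).mpr ⟨(normOneUnits ι hO).mul_mem ((normOneUnits ι hO).inv_mem (hT t ht)) hγ, x, hx, hxι, hy⟩⟩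
  have hfi : (Γ'.subgroupOf (normOneUnits ι hO)).FiniteIndex := by
    let φ : T → normOneUnits ι hO ⧸ Γ'.subgroupOf (normOneUnits ι hO) := fun t => QuotientGroup.mk ⟨(t : GL (Fin 2) ℝ), hT t t.2⟩
    have hφ : Function.Surjective φ := by
      intro c
      induction c using QuotientGroup.induction_on with
      | H γ =>
        obtain ⟨t, ht, htγ⟩ := hcos' γ γ.2
        refine ⟨⟨t, ht⟩, QuotientGroup.eq.mpr ?_⟩
        rw [Subgroup.mem_subgroupOf]
        simpa using htγ
    haveI : Finite (normOneUnits ι hO ⧸ Γ'.subgroupOf (normOneUnits ι hO)) := Finite.of_surjective φ hφ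
    exact Subgroup.finiteIndex_of_finite_quotient
  -- inside the conjugated Hodge group `h Γ_{a,b} h⁻¹`: proper discontinuity
  have hsub : ∀ γ ∈ Γ', ∃ g ∈ QuaternionType.unitGroup a b hb.le, γ = h * Matrix.SpecialLinearGroup.toGL g * h⁻¹ := by
    intro γ hγ
    obtain ⟨hγ₁, x, hx, hxγ, y, hy, hxy⟩ := (hmemΓ' _).mp hγ
    -- `f x = 1 + L • f y ∈ 𝔬`
    have hfx : f x ∈ QuaternionType.order a b := by
      have e : f x = 1 + (3 : ℤ) • ((n.natAbs : ℤ) • f y) := by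
        rw [sub_eq_iff_eq_add'.mp hxy, map_add, map_one, map_zsmul, smul_smul, hLdef]
        push_cast
        rfl
      rw [e]
      exact (QuaternionType.order a b).add_mem (QuaternionType.order a b).one_mem (zsmul_mem (hnmem y hy) 3)
    -- `det ρ(f x) = det ι(x) = 1`
    have hdetι : (ι x).det = 1 := by
      rw [hxγ, ← Matrix.GeneralLinearGroup.val_det_apply, hγ₁.2.2, Units.val_one]
    have hdetρ : (QuaternionType.rho a b hb.le (QuaternionType.castQ a b (f x))).det = 1 := by
      have h1 := hdetι
      rw [hconj x, Matrix.det_mul, Matrix.det_mul, mul_comm ((h : Matrix (Fin 2) (Fin 2) ℝ).det), mul_assoc, ← Matrix.det_mul,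
        ← Units.val_mul, mul_inv_cancel, Units.val_one, Matrix.det_one, mul_one] at h1
      exact h1
    refine ⟨⟨QuaternionType.rho a b hb.le (QuaternionType.castQ a b (f x)), hdetρ⟩, ⟨f x, hfx, mul_star_eq_one_of_det hb.le hdetρ, rfl⟩, ?_⟩
    apply Units.ext
    rw [Units.val_mul, Units.val_mul, Matrix.SpecialLinearGroup.coe_GL_coe_matrix, ← hxγ, hconj x]
  have hpd : ProperlyDiscontinuousSMul Γ' UpperHalfPlane :=
    properlyDiscontinuousSMul_of_forall_eq_conj Γ' (QuaternionType.properlyDiscontinuousSMul_unitGroup ha hb) h hsub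
  -- torsion-free (Minkowski at `ℓ = 3`)
  have htf : ∀ γ : Γ', IsOfFinOrder γ → γ = 1 := by
    intro γ hfin
    obtain ⟨-, x, hx, hxγ, y, hy, hxy⟩ := (hmemΓ' _).mp γ.2
    have hfin' : IsOfFinOrder (γ : GL (Fin 2) ℝ) := Γ'.subtype.isOfFinOrder hfin
    have h3 : ∃ x ∈ O, ι x = ((γ : GL (Fin 2) ℝ) : Matrix (Fin 2) (Fin 2) ℝ) ∧ ∃ y ∈ O, x - 1 = ((3 : ℕ) : ℤ) • y := by
      refine ⟨x, hx, hxγ, (n.natAbs : ℤ) • y, O.smul_mem _ hy, ?_⟩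
      rw [hxy, smul_smul, hLdef]
      push_cast
      ring_nf
    exact Subtype.ext (eq_one_of_isOfFinOrder_of_sub_one_mem ι hι hO Nat.prime_three (by norm_num) hfin' h3)
  -- cocompact
  obtain ⟨K, hK, hcov⟩ := exists_isCompact_forall_exists_mem_normOneUnits_smul_mem B O hO ι hdiv
  obtain ⟨K₁, hK₁, hcov₁⟩ := exists_isCompact_reps_of_finset_leftCosets hK hcov T hcos'
  exact ⟨Γ', hle, hnormal, hfi, hpd, htf, K₁, hK₁, hcov₁⟩
end TorsionFreeLevel

/-! ## §4 Assembly: surjectivity for every order of every division algebra -/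

section Assembly
variable {B : Type*} [Ring B] [Algebra ℚ B] [IsQuaternionAlgebra ℚ B] (ι : B →ₐ[ℚ] Matrix (Fin 2) (Fin 2) ℝ) {O : Submodule ℤ B} (hO : Brandt.IsOrder B O)

omit [IsQuaternionAlgebra ℚ B] in
/-- **Surjectivity on `ι(O¹)` from a good level.** If `Γ' ≤ ι(O¹)` is normal of finite index, properly discontinuous, torsion-free and cocompact, and `B` is a division algebra
(no cusps), then every additive `u : ι(O¹) → ℝ` is a real period cochain of a weight-two cusp form on `ι(O¹)` (`esSurj_of_compactQuotient` on `Γ'∖ℍ`, then the descent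
`esSurj_of_normal_finiteIndex`). [cite: ShimuraIATAF1971, Thm. 8.4 p. 234 and §8.1 (8.1.2)–(8.1.3)] [cite: FarkasKra1992, III.3.4 Corollary (b)] -/
theorem esSurj_normOneUnits_of_level (hι : Function.Injective ι) (hdiv : ∀ x : B, x ≠ 0 → IsUnit x) (Γ' : Subgroup (GL (Fin 2) ℝ))
    (hle : Γ' ≤ normOneUnits ι hO) (hN : (Γ'.subgroupOf (normOneUnits ι hO)).Normal) (hfi : (Γ'.subgroupOf (normOneUnits ι hO)).FiniteIndex)
    (hpd : ProperlyDiscontinuousSMul Γ' UpperHalfPlane) (htf : ∀ γ : Γ', IsOfFinOrder γ → γ = 1)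
    {K : Set UpperHalfPlane} (hK : IsCompact K) (hcov : ∀ z : UpperHalfPlane, ∃ γ ∈ Γ', γ • z ∈ K)
    (z₀ : UpperHalfPlane) (u : normOneUnits ι hO → ℝ) (hu : ∀ γ δ : normOneUnits ι hO, u (γ * δ) = u γ + u δ) :
    ∃ F : CuspForm (normOneUnits ι hO) 2, ∀ γ : normOneUnits ι hO, CuspForm.rePeriod F z₀ γ = u γ := by
  haveI : Γ'.HasDetOne := ⟨fun hg => Subgroup.HasDetOne.det_eq (hle hg)⟩
  haveI := hpd
  haveI : IsCancelSMul Γ' UpperHalfPlane := isCancelSMul_of_torsionFree Γ' htf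
  haveI : CompactSpace (MulAction.orbitRel.Quotient Γ' UpperHalfPlane) := compactSpace_orbitQuotient_of_reps Γ' hK hcov
  have hcusp : ∀ c : OnePoint ℝ, ¬ IsCusp c Γ' := fun c hc => not_isCusp_normOneUnits ι hO hι hdiv c (hc.mono hle)
  exact esSurj_of_normal_finiteIndex hle hN hfi z₀ (fun u₁ hu₁ => esSurj_of_compactQuotient Γ' hcusp hK hcov z₀ u₁ hu₁) u hu

/-- **THE SURJECTIVITY HALF OF (ESᶜ) FOR EVERY ORDER OF EVERY INDEFINITE DIVISION QUATERNION ALGEBRA** (Shimura Thm. 8.4 at `n = 0`, surjectivity, `Γ = ι(O¹)`, `B` a skew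
field): every additive `u : ι(O¹) → ℝ` is the real period cochain `γ ↦ Re ∫_{z₀}^{γ z₀} F` of a weight-two cusp form `F` on `ι(O¹)`.
[cite: ShimuraIATAF1971, Thm. 8.4 p. 234; §9.2 p. 246] [cite: FarkasKra1992, III.3.4 Corollary (b)] -/
theorem esSurj_normOneUnits_of_forall_isUnit (hι : Function.Injective ι) (hdiv : ∀ x : B, x ≠ 0 → IsUnit x) (z₀ : UpperHalfPlane)
    (u : normOneUnits ι hO → ℝ) (hu : ∀ γ δ : normOneUnits ι hO, u (γ * δ) = u γ + u δ) :
    ∃ F : CuspForm (normOneUnits ι hO) 2, ∀ γ : normOneUnits ι hO, CuspForm.rePeriod F z₀ γ = u γ := by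
  obtain ⟨Γ', hle, hN, hfi, hpd, htf, K, hK, hcov⟩ := exists_torsionFree_level_subgroup ι hO hι hdiv
  exact esSurj_normOneUnits_of_level ι hO hι hdiv Γ' hle hN hfi hpd htf hK hcov z₀ u hu
end Assembly

/-! ## §5 Packaging: the hypothesis `hdivSurj` of the (ESᶜ) residue bridges, and (ESᶜ) from its cusp-case residues -/

section Packaging
/-- **`hdivSurj` IS A THEOREM**: the surjectivity conjunct of (ESᶜ) restricted to the division algebras, in EXACTLY the binder shape of the hypothesis `hdivSurj` of
`Literature.NumberTheory.Automorphic.eichlerShimura_weightTwo_rePeriod_surjective_of_residue` ∕ `…_of_cusp_residue` (the parabolic-null clause is not even needed).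
[cite: ShimuraIATAF1971, Thm. 8.4 p. 234; §9.2 p. 246] [cite: FarkasKra1992, III.3.4 Corollary (b)] -/
theorem eichlerShimura_weightTwo_rePeriod_surjective_of_forall_isUnit :
    ∀ (B : Type) [Ring B] [Algebra ℚ B] [IsQuaternionAlgebra ℚ B] (O : Submodule ℤ B) (hO : Brandt.IsOrder B O)
      (ι : B →ₐ[ℚ] Matrix (Fin 2) (Fin 2) ℝ), Function.Injective ι → (∀ x : B, x ≠ 0 → IsUnit x) →
      ∀ z₀ : UpperHalfPlane, ∀ u : normOneUnits ι hO → ℝ,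
        (∀ γ δ : normOneUnits ι hO, u (γ * δ) = u γ + u δ) →
        (∀ γ : normOneUnits ι hO, (γ : GL (Fin 2) ℝ).IsParabolic → u γ = 0) →
        ∃ F : CuspForm (normOneUnits ι hO) 2, ∀ γ : normOneUnits ι hO, CuspForm.rePeriod F z₀ γ = u γ :=
  fun _ _ _ _ _ hO ι hι hdiv z₀ u hu _ => esSurj_normOneUnits_of_forall_isUnit ι hO hι hdiv z₀ u hu

/-- **(ESᶜ-surj) FROM ITS CUSP-CASE RESIDUE ALONE**: the named fact `eichlerShimura_weightTwo_rePeriod_surjective` follows from (ESᶜ-surj-split)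
`eichlerShimura_weightTwo_rePeriod_surjective_of_exists_not_isUnit` (the case `B ≅ M₂(ℚ)`), the division case being the theorem above.
[cite: ShimuraIATAF1971, Thm. 8.4 p. 234; §9.2 p. 246] -/
theorem eichlerShimura_weightTwo_rePeriod_surjective_of_split (hsplit : eichlerShimura_weightTwo_rePeriod_surjective_of_exists_not_isUnit) :
    eichlerShimura_weightTwo_rePeriod_surjective :=
  eichlerShimura_weightTwo_rePeriod_surjective_of_residue eichlerShimura_weightTwo_rePeriod_surjective_of_forall_isUnit hsplit

/-- **(ESᶜ) FROM ITS TWO CUSP-CASE RESIDUES ALONE** — (ESᶜ-inj-split) `eichlerShimura_weightTwo_rePeriod_injective_of_exists_not_isUnit` and (ESᶜ-surj-split)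
`eichlerShimura_weightTwo_rePeriod_surjective_of_exists_not_isUnit` (both about `B ≅ M₂(ℚ)`: cusps): the division-algebra halves are the theorems
`eichlerShimura_weightTwo_rePeriod_injective_of_forall_isUnit` (defn-ty1 g45, `QuaternionOrderUnitsCocompact`) and `eichlerShimura_weightTwo_rePeriod_surjective_of_forall_isUnit`
(this file). So a cite stub consuming (ESᶜ) may list exactly these two residues instead. [cite: ShimuraIATAF1971, Thm. 8.4 p. 234; §9.2 p. 246] -/
theorem eichlerShimura_weightTwo_rePeriod_of_cusp_residue' (hinj : eichlerShimura_weightTwo_rePeriod_injective_of_exists_not_isUnit)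
    (hsurj : eichlerShimura_weightTwo_rePeriod_surjective_of_exists_not_isUnit) : eichlerShimura_weightTwo_rePeriod :=
  eichlerShimura_weightTwo_rePeriod_of_cusp_residue eichlerShimura_weightTwo_rePeriod_injective_of_forall_isUnit
    eichlerShimura_weightTwo_rePeriod_surjective_of_forall_isUnit hinj hsurj
end Packaging

end Summit.BirchSwinnertonDyer.BirchSwinnertonDyer.Theorems.CartanCover.PrintClauses

end
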